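/-
Copyright: the b2b-balaban T⁴-continuum CRUX team, row NE7b OWNER lineage `t4-ne7b-p1` (gen 137). Project licence.
-/
import Summits.QuantumFields.BalabanUV.T4Continuum.Spine.NE7b.SupTiltedTransfer
import Literature.Probability.Moments.BrascampLiebVarianceViaPrekopaLeindler

/-!
# THE POINCARÉ INEQUALITY OF THE STEP'S TILTED LAW — BRASCAMP–LIEB ON THE GAUSSIAN ROAD, the class-closure plan, item (d).  For a `C¹` block
# potential `U` with the secant lower letter `λ ≥ 0` on ALL sites and `M ≻ 0` of floor `m > λ`: the tilted probability law
# `ν_ψ = Z(ψ)⁻¹e^{−U(ω+ψ)}dN(0,M⁻¹)(ω)` of the fluctuation step is `(m−λ)`-uniformly log-concave, so for EVERY `C¹` observable `g` with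
# `g, g², ‖Dg‖²` integrable against `e^{−U(·+ψ)}dN(0,M⁻¹)`,
#   `Var_{ν_ψ}(g) = Z⁻¹∫e^{−U}g² − (Z⁻¹∫e^{−U}g)² ≤ (m−λ)⁻¹·Z⁻¹∫e^{−U(ω+ψ)}‖Dg(ω)‖² dN(0,M⁻¹)(ω)`
# — the tree's Brascamp–Lieb variance inequality `Literature.Probability.Moments.variance_tilted_le` [cite: BrascampLieb1976, Thm 4.1] read through
# (421)'s transfer dictionary (reindexing isometry `ℝ^ι ≃ₗᵢ ℝⁿ`, the Gaussian weight as a Lebesgue density); UNIFORM in `ψ` and in the volume —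
# the concentration input that makes the output's third-order letter `κ₃⁺` uniform (successor file) (row NE7b, node U5c; (421) BY NAME;
# [cite: BrascampLieb1976, Thm 4.1])

Cell `pub-balaban`, sub-cell `t4`, spine estimate NE7b (`T4WeightBudget.RelWeightBound`; the cell's OWN estimate — NOT PRINTED in
[Bałaban 1983–89], NOT PROVED).  Crux-route work under `Spine/NE7b/` by the row OWNER (`t4-ne7b-p1` gen 137, file (422)) under FREEZE
(0)'s crux-prover clause (this gen's class-closure audit, item (d)); NOTHING of Bałaban's is named as a Lean object, valued or asserted; no
`T4Continuum/Support` leaf typed; no `def`, no notation; zero `sorry`.  Imports (BY NAME): the OWNER's (421) `…SupTiltedTransfer`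
(`tilted_integral_transfer`, `tilted_integrable_transfer`, `exp_neg_V_integrable`, `integral_exp_neg_V`, `V_continuous`, `V_firstOrder_convex`);
the tree's `Literature.Probability.Moments.variance_tilted_le` (Brascamp–Lieb 1976, Thm 4.1, PROVED in the tree via Prékopa–Leindler).

WHAT IS PROVED ([folklore] bookkeeping; [cite: BrascampLieb1976, Thm 4.1] for the inequality):
* §1 `tilted_expectation_transfer` (`∫F(e⁻¹y)dν_V(y) = Z⁻¹∫e^{−U(ω+ψ)}F(ω)dN(0,M⁻¹)`), `contDiff_one_of_hasFDerivAt`, `fderiv_comp_isometry_norm`;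
* §2 THE END **`tilted_poincare`** (the display); §3 toy.

HONEST (what this is NOT).  The Poincaré constant `(m−λ)⁻¹` uses the GLOBAL secant letter of `U` (all sites) and the floor of `M`; no
Brascamp–Lieb with the full Hessian, no log-Sobolev; the fourth centred moment and the uniform `κ₃⁺` are the successor's; no contraction
((β4)), no decaying-covariance polymer expansion ((β3′)); scalar skeleton ((A3), NC-NE7b-α UNRULED); nothing of Bałaban's asserted.  BY-NAME
EFFECT ON THE WALL: NONE.  NE7b NOT PRINTED ∕ NOT PROVED; spine PROVED 0∕9; rung (B)+1 — the programme's measures remain FINITE-torus statements;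
NOT the mass gap, NOT Clay.  HONEST DEPENDENCY: continuum YM on T⁴ ⇐ BetaPertH ∧ nine spine estimates (0∕9 proved); BetaPertH ⇐ (D1) ∧ (D4) ∧
CAP+tail; G-an2-4 gates asym, D1 and NE2∕3∕4.
-/

set_option autoImplicit false

noncomputable section

namespace Summit.QuantumFields.BalabanUV.T4Continuum.NE7b.SupTiltedPoincare

open MeasureTheory ProbabilityTheory Finset Real
open scoped BigOperators ENNReal Matrix RealInnerProductSpace
open Literature.MathematicalPhysics.QuantumFieldTheory.Balaban1983to89
open B13GaugeDevices (gaussNorm)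
open B2Eq228Conditioning (gaussNorm_pos)
open SupTiltedTransfer (tilted_integral_transfer tilted_integrable_transfer exp_neg_V_integrable integral_exp_neg_V V_continuous
  V_firstOrder_convex)
open Literature.Probability.Moments (variance_tilted_le)

variable {ι : Type} [Fintype ι] [DecidableEq ι] {n : ℕ}

section Main

variable {M : Matrix ι ι ℝ} {m lam : ℝ} {U : EuclideanSpace ℝ ι → ℝ} {U' : EuclideanSpace ℝ ι → EuclideanSpace ℝ ι →L[ℝ] ℝ}

/-! ## §1. Expectations under the Lebesgue tilt are tilted expectations on the Gaussian road -/

/-- **`∫F(e⁻¹y)dν_V(y) = Z(ψ)⁻¹·∫e^{−U(ω+ψ)}F(ω)dN(0,M⁻¹)(ω)`** for EVERY `F`, `ν_V = e^{−V}dy∕∫e^{−V}` ((421) + `integral_tilted`). [folklore] -/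
theorem tilted_expectation_transfer (hM : M.PosDef) (e : EuclideanSpace ℝ ι ≃ₗᵢ[ℝ] EuclideanSpace ℝ (Fin n)) (ψ : EuclideanSpace ℝ ι)
    (hI : Integrable (fun ω : EuclideanSpace ℝ ι => exp (-U (ω + ψ))) (multivariateGaussian 0 M⁻¹)) (F : EuclideanSpace ℝ ι → ℝ) :
    ∫ y : EuclideanSpace ℝ (Fin n), F (e.symm y) ∂(volume.tilted fun y : EuclideanSpace ℝ (Fin n) =>
        -(U (e.symm y + ψ) + 1 / 2 * ((WithLp.ofLp (e.symm y)) ⬝ᵥ (M *ᵥ (WithLp.ofLp (e.symm y)))))) =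
      (∫ ω : EuclideanSpace ℝ ι, exp (-U (ω + ψ)) ∂(multivariateGaussian 0 M⁻¹))⁻¹ *
        ∫ ω : EuclideanSpace ℝ ι, exp (-U (ω + ψ)) * F ω ∂(multivariateGaussian 0 M⁻¹) := by
  have hN := gaussNorm_pos hM
  have hZ : 0 < ∫ ω : EuclideanSpace ℝ ι, exp (-U (ω + ψ)) ∂(multivariateGaussian 0 M⁻¹) := integral_exp_pos hI
  rw [integral_tilted, integral_exp_neg_V hM e ψ]
  have e1 : ∀ y : EuclideanSpace ℝ (Fin n),
      (exp (-(U (e.symm y + ψ) + 1 / 2 * ((WithLp.ofLp (e.symm y)) ⬝ᵥ (M *ᵥ (WithLp.ofLp (e.symm y)))))) /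
          (gaussNorm M * ∫ ω : EuclideanSpace ℝ ι, exp (-U (ω + ψ)) ∂(multivariateGaussian 0 M⁻¹))) • F (e.symm y) =
        (gaussNorm M * ∫ ω : EuclideanSpace ℝ ι, exp (-U (ω + ψ)) ∂(multivariateGaussian 0 M⁻¹))⁻¹ *
          (F (e.symm y) * exp (-(U (e.symm y + ψ) + 1 / 2 * ((WithLp.ofLp (e.symm y)) ⬝ᵥ (M *ᵥ (WithLp.ofLp (e.symm y))))))) := fun y => by
    rw [smul_eq_mul]; ring
  simp_rw [e1]
  rw [integral_const_mul, tilted_integral_transfer hM e ψ F]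
  field_simp

omit [DecidableEq ι] in
/-- `U ∈ C¹` in Mathlib's `ContDiff` sense from `HasFDerivAt` everywhere with a continuous derivative map. [folklore] -/
theorem contDiff_one_of_hasFDerivAt {g : EuclideanSpace ℝ ι → ℝ} {g' : EuclideanSpace ℝ ι → EuclideanSpace ℝ ι →L[ℝ] ℝ}
    (hg : ∀ ω : EuclideanSpace ℝ ι, HasFDerivAt g (g' ω) ω) (hg'c : Continuous g') : ContDiff ℝ 1 g := by
  rw [contDiff_one_iff_fderiv]
  refine ⟨fun ω => (hg ω).differentiableAt, ?_⟩
  have e : fderiv ℝ g = g' := funext fun ω => (hg ω).fderiv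
  rw [e]; exact hg'c

omit [DecidableEq ι] in
/-- The derivative of `g ∘ e⁻¹` and its norm (precomposition with a linear isometry). [folklore] -/
theorem fderiv_comp_isometry_norm (e : EuclideanSpace ℝ ι ≃ₗᵢ[ℝ] EuclideanSpace ℝ (Fin n)) {g : EuclideanSpace ℝ ι → ℝ}
    {g' : EuclideanSpace ℝ ι → EuclideanSpace ℝ ι →L[ℝ] ℝ} (hg : ∀ ω : EuclideanSpace ℝ ι, HasFDerivAt g (g' ω) ω)
    (y : EuclideanSpace ℝ (Fin n)) :
    ‖fderiv ℝ (fun y : EuclideanSpace ℝ (Fin n) => g (e.symm y)) y‖ = ‖g' (e.symm y)‖ := by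
  have hd : HasFDerivAt (fun y : EuclideanSpace ℝ (Fin n) => g (e.symm y))
      ((g' (e.symm y)).comp (e.symm : EuclideanSpace ℝ (Fin n) →L[ℝ] EuclideanSpace ℝ ι)) y :=
    (hg (e.symm y)).comp y ((e.symm : EuclideanSpace ℝ (Fin n) →L[ℝ] EuclideanSpace ℝ ι).hasFDerivAt)
  rw [hd.fderiv, ContinuousLinearMap.opNorm_comp_linearIsometryEquiv]

/-! ## §2. THE END: the Poincaré inequality of the tilted law -/

/-- **THE POINCARÉ INEQUALITY OF THE STEP'S TILTED LAW (Brascamp–Lieb).**  `M ≻ 0` with floor `m·Σz² ≤ ⟨z,Mz⟩`; `U ∈ C¹` (`HasFDerivAt`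
everywhere) with the secant lower letter of constant `λ ≥ 0` on all sites; `λ < m`; `e^{−U(·+ψ)}` integrable for `N(0,M⁻¹)`; a `C¹` observable
`g` (`HasFDerivAt g (g′ ω) ω`, `g′` continuous) with `e^{−U(·+ψ)}g`, `e^{−U(·+ψ)}g²`, `e^{−U(·+ψ)}‖g′‖²` integrable ⟹ with
`Z = ∫e^{−U(ω+ψ)}dN(0,M⁻¹)`:
`Z⁻¹∫e^{−U(ω+ψ)}g(ω)² − (Z⁻¹∫e^{−U(ω+ψ)}g(ω))² ≤ (m−λ)⁻¹·Z⁻¹∫e^{−U(ω+ψ)}‖g′(ω)‖²` (all integrals `dN(0,M⁻¹)`). [cite: BrascampLieb1976, Thm 4.1] -/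
theorem tilted_poincare (hM : M.PosDef) (hfl : ∀ z : ι → ℝ, m * ∑ i, z i ^ 2 ≤ z ⬝ᵥ (M *ᵥ z))
    (hUd : ∀ φ : EuclideanSpace ℝ ι, HasFDerivAt U (U' φ) φ) (hlam : 0 ≤ lam)
    (hUsec : ∀ s : ℝ, 0 ≤ s → s ≤ 1 → ∀ a b : EuclideanSpace ℝ ι,
      U ((1 - s) • a + s • b) - lam / 2 * (s * (1 - s)) * ∑ i, (a i - b i) ^ 2 ≤ (1 - s) * U a + s * U b)
    (hρ : lam < m) (ψ : EuclideanSpace ℝ ι)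
    (hI : Integrable (fun ω : EuclideanSpace ℝ ι => exp (-U (ω + ψ))) (multivariateGaussian 0 M⁻¹))
    {g : EuclideanSpace ℝ ι → ℝ} {g' : EuclideanSpace ℝ ι → EuclideanSpace ℝ ι →L[ℝ] ℝ}
    (hg : ∀ ω : EuclideanSpace ℝ ι, HasFDerivAt g (g' ω) ω) (hg'c : Continuous g')
    (h1 : Integrable (fun ω : EuclideanSpace ℝ ι => exp (-U (ω + ψ)) * g ω) (multivariateGaussian 0 M⁻¹))
    (h2 : Integrable (fun ω : EuclideanSpace ℝ ι => exp (-U (ω + ψ)) * g ω ^ 2) (multivariateGaussian 0 M⁻¹))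
    (h3 : Integrable (fun ω : EuclideanSpace ℝ ι => exp (-U (ω + ψ)) * ‖g' ω‖ ^ 2) (multivariateGaussian 0 M⁻¹)) :
    (∫ ω : EuclideanSpace ℝ ι, exp (-U (ω + ψ)) ∂(multivariateGaussian 0 M⁻¹))⁻¹ *
          ∫ ω : EuclideanSpace ℝ ι, exp (-U (ω + ψ)) * g ω ^ 2 ∂(multivariateGaussian 0 M⁻¹) -
        ((∫ ω : EuclideanSpace ℝ ι, exp (-U (ω + ψ)) ∂(multivariateGaussian 0 M⁻¹))⁻¹ *
          ∫ ω : EuclideanSpace ℝ ι, exp (-U (ω + ψ)) * g ω ∂(multivariateGaussian 0 M⁻¹)) ^ 2 ≤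
      (m - lam)⁻¹ * ((∫ ω : EuclideanSpace ℝ ι, exp (-U (ω + ψ)) ∂(multivariateGaussian 0 M⁻¹))⁻¹ *
        ∫ ω : EuclideanSpace ℝ ι, exp (-U (ω + ψ)) * ‖g' ω‖ ^ 2 ∂(multivariateGaussian 0 M⁻¹)) := by
  -- reindex the sites by `Fin n`
  set e : EuclideanSpace ℝ ι ≃ₗᵢ[ℝ] EuclideanSpace ℝ (Fin (Fintype.card ι)) :=
    LinearIsometryEquiv.piLpCongrLeft 2 ℝ ℝ (Fintype.equivFin ι) with he
  -- the Lebesgue tilt and the Brascamp–Lieb hypotheses ((421))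
  have hVc := V_continuous (M := M) e hUd ψ
  have hV := V_firstOrder_convex hM hfl e hUd hlam hUsec ψ
  have hZ := exp_neg_V_integrable hM e ψ hI
  have hf : ContDiff ℝ 1 (fun y : EuclideanSpace ℝ (Fin (Fintype.card ι)) => g (e.symm y)) :=
    (contDiff_one_of_hasFDerivAt hg hg'c).comp e.symm.contDiff
  -- integrability against the tilt from (421)'s transfer
  have hi1 : Integrable (fun y : EuclideanSpace ℝ (Fin (Fintype.card ι)) => g (e.symm y))
      (volume.tilted fun y : EuclideanSpace ℝ (Fin (Fintype.card ι)) =>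
        -(U (e.symm y + ψ) + 1 / 2 * ((WithLp.ofLp (e.symm y)) ⬝ᵥ (M *ᵥ (WithLp.ofLp (e.symm y)))))) :=
    (integrable_tilted_iff hZ _).2 ((tilted_integrable_transfer hM e ψ h1).congr (ae_of_all _ fun y => by
      simp only [smul_eq_mul]; ring))
  have hi2 : Integrable (fun y : EuclideanSpace ℝ (Fin (Fintype.card ι)) => g (e.symm y) ^ 2)
      (volume.tilted fun y : EuclideanSpace ℝ (Fin (Fintype.card ι)) =>
        -(U (e.symm y + ψ) + 1 / 2 * ((WithLp.ofLp (e.symm y)) ⬝ᵥ (M *ᵥ (WithLp.ofLp (e.symm y)))))) :=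
    (integrable_tilted_iff hZ _).2 ((tilted_integrable_transfer hM e ψ h2).congr (ae_of_all _ fun y => by
      simp only [smul_eq_mul]; ring))
  have hi3 : Integrable (fun y : EuclideanSpace ℝ (Fin (Fintype.card ι)) =>
      ‖fderiv ℝ (fun y : EuclideanSpace ℝ (Fin (Fintype.card ι)) => g (e.symm y)) y‖ ^ 2)
      (volume.tilted fun y : EuclideanSpace ℝ (Fin (Fintype.card ι)) =>
        -(U (e.symm y + ψ) + 1 / 2 * ((WithLp.ofLp (e.symm y)) ⬝ᵥ (M *ᵥ (WithLp.ofLp (e.symm y)))))) := by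
    have h := (integrable_tilted_iff hZ (fun y : EuclideanSpace ℝ (Fin (Fintype.card ι)) => ‖g' (e.symm y)‖ ^ 2)).2
      ((tilted_integrable_transfer hM e ψ h3).congr (ae_of_all _ fun y => by simp only [smul_eq_mul]; ring))
    exact h.congr (ae_of_all _ fun y => by simp only [fderiv_comp_isometry_norm e hg y])
  -- Brascamp–Lieb
  have key := variance_tilted_le (sub_pos.2 hρ) hVc hV hZ hf hi1 hi2 hi3
  -- read the three integrals on the Gaussian road
  have r1 := tilted_expectation_transfer hM e ψ hI g
  have r2 := tilted_expectation_transfer hM e ψ hI (fun ω => g ω ^ 2)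
  have r3 := tilted_expectation_transfer hM e ψ hI (fun ω => ‖g' ω‖ ^ 2)
  have e3 : ∫ y : EuclideanSpace ℝ (Fin (Fintype.card ι)), ‖fderiv ℝ (fun y : EuclideanSpace ℝ (Fin (Fintype.card ι)) => g (e.symm y)) y‖ ^ 2
      ∂(volume.tilted fun y : EuclideanSpace ℝ (Fin (Fintype.card ι)) =>
        -(U (e.symm y + ψ) + 1 / 2 * ((WithLp.ofLp (e.symm y)) ⬝ᵥ (M *ᵥ (WithLp.ofLp (e.symm y)))))) =
      ∫ y : EuclideanSpace ℝ (Fin (Fintype.card ι)), ‖g' (e.symm y)‖ ^ 2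
      ∂(volume.tilted fun y : EuclideanSpace ℝ (Fin (Fintype.card ι)) =>
        -(U (e.symm y + ψ) + 1 / 2 * ((WithLp.ofLp (e.symm y)) ⬝ᵥ (M *ᵥ (WithLp.ofLp (e.symm y)))))) :=
    integral_congr_ae (ae_of_all _ fun y => by simp only [fderiv_comp_isometry_norm e hg y])
  rw [e3, r1, r3] at key
  rw [show (∫ y : EuclideanSpace ℝ (Fin (Fintype.card ι)), g (e.symm y) ^ 2
      ∂(volume.tilted fun y : EuclideanSpace ℝ (Fin (Fintype.card ι)) =>
        -(U (e.symm y + ψ) + 1 / 2 * ((WithLp.ofLp (e.symm y)) ⬝ᵥ (M *ᵥ (WithLp.ofLp (e.symm y))))))) = _ from r2] at key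
  exact key

end Main

/-! ## §3. Toy -/

/-- Toy (§1): a function with an everywhere-vanishing derivative is `C¹`. -/
example (c : ℝ) : ContDiff ℝ 1 (fun _ : EuclideanSpace ℝ ι => c) :=
  contDiff_one_of_hasFDerivAt (g' := fun _ => 0) (fun ω => hasFDerivAt_const c ω) continuous_const

end Summit.QuantumFields.BalabanUV.T4Continuum.NE7b.SupTiltedPoincare
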